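import Summits.CriticalPhenomena.PercolationContinuityZ3.Theorems.PercNearOneGluingNoHeavyLowerTailCubicThreePointTerminalClosure
import Mathlib.Tactic.Linarith
import Mathlib.Tactic.Ring
import Mathlib.Tactic.Positivity
import HarnessLib

/-!
# `NoHeavyLowerTail` (stmt-CriticalPhenomena-4575) — cubic three-point rows: the chord identity of an ARBITRARY coordinate

Support file (prover prim-ineq-gen-6 gen 3, new-inequality factory; `--supports stmt-CriticalPhenomena-4575`).  Pure algebra over a
commutative ring / `ℝ`: no measure theory, no definitions, no named facts, no sorries.  Companion of
`PercNearOneGluingNoHeavyLowerTailCubicThreePointTerminalClosure` (prim-ineq-gen-5: the polynomials `AG`, `Xi`, `Hqt`) and of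
`PercNearOneGluingNoHeavyLowerTailCubicThreePointEasySteps` (prim-ineq-gen-2: the terminal–terminal and pendant special cases).
Cell convention `(q,u₁,u₂,u₃,t) = (P(a|b|c), P(ab|c), P(ac|b), P(bc|a), P(abc))`.

WHAT.  Conditioning a three-point connectivity law on ONE ARBITRARY edge `e` (weight `l`) — more generally one coordinate of ANY monotone
map `{0,1}^n → Π₃` (the partition lattice of three points is the diamond `M₃`; bond/site/hypergraph laws are such maps) — writes the law as
`x_l = (1−l)·x⁰ + l·x¹` (`x⁰` = law of `G∖e`, `x¹` = law of `G/e`), and monotonicity allows exactly seven transition masses when `e` opens: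
`s_i : a|b|c → (petal i)`, `m : a|b|c → abc`, `r_i : (petal i) → abc` (petals `u₁ = ab|c, u₂ = ac|b, u₃ = bc|a`; a petal never moves to another
petal).  So `x¹ = (q − s₁ − s₂ − s₃ − m, u₁ + s₁ − r₁, u₂ + s₂ − r₂, u₃ + s₃ − r₃, t + m + r₁ + r₂ + r₃)`; the apex-edge files are the case
`s₃ = m = 0`.  With the Russo derivatives `τ := dt/dl = m + r₁+r₂+r₃`, `σ' := −dq/dl = m + s₁+s₂+s₃`, `d_i := du_i/dl = s_i − r_i`
(`τ − σ' + Σ d_i = 0`) and `Γ := τσ' + e₂(d)`: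
* `AG_coord_chord`:  `AG(x_l) = (1−l)AG(x⁰) + l·AG(x¹) + l(1−l)·Γ`  and  `Γ = m² + m(r+s) + Σ_i r_i s_i + e₂(r) + e₂(s) ≥ 0`
  (`coordGamma_eq`, `coordGamma_nonneg`): Gladkov's concavity step [Gladkov 2024, proof of Thm. 2.1] for a general coordinate, in closed form
  (`AG_coord_chord_ge`);
* `Xi_coord_chord`:  `Ξ(x_l) = (1−l)Ξ(x⁰) + l·Ξ(x¹) + l(1−l)·K_l`,  `K_l = σ·Γ + Σ_{i<j} d_i d_j u_k + (1+l)·d₁d₂d₃`  (`σ` = total mass; `Ξ = σ·AG − e₃`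
  is AG⁺);
* `Hqt_coord_chord`: `Hqt(x_l) = (1−l)Hqt(x⁰) + l·Hqt(x¹) + l(1−l)·[K_l + (Σd)(AG(x¹) − AG(x⁰)) − (u₁+u₂+u₃ + lΣd)·Γ]`;
* `Xi_coord_chord_ge_of_sameSign`: if the three petal derivatives `d_i` have ONE SIGN (e.g. the coordinate never creates the first link out of
  `a|b|c`, or never completes `abc`), then `K_l ≥ 0`, so AG⁺ is CONCAVE across that coordinate and `Ξ(x⁰), Ξ(x¹) ≥ 0 ⇒ Ξ(x_l) ≥ 0`
  (`Xi_coord_nonneg_of_sameSign`) — a graph-free third 'easy case' beside the terminal–terminal and pendant apex edges.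
Numerics behind the file (this seat, run/shared/lean/prim/prim-ineq-gen-6/FINDING-G3.md §G6): the identities agree with direct evaluation to 1e-16 on
all 21.1 M monotone maps with n ≤ 5; every coordinate violating `K_l ≥ 0` is mixed-sign (66,915/66,915 at n = 5); some coordinate with `K_l ≥ 0`
exists in all 3.17 M instances with n ≤ 5 but not at the hexagon (n = 6), where the normalised potential `Ξ/(1−q)` is needed (prim-ineq-gen-2, EDGE-STEP.md).
[cite: Gladkov2024StrongFKG, Thm. 2.1 and its proof (the quadratic step)]; [cite: GladkovZimin2024HK, §4 (one-coordinate decomposition)]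
-/

namespace Summit.CriticalPhenomena.PercolationContinuityZ3.Theorems

namespace CubicThreePointCoordinate

open CubicThreePointTerminal

section Identities

variable {R : Type*} [CommRing R]

/-- **Gladkov's quadratic step for an arbitrary coordinate, closed form.**  Along `x_l = x⁰ + l(x¹ − x⁰)` with the seven monotone
transition masses `(s₁,s₂,s₃,m,r₁,r₂,r₃)`:  `AG(x_l) = (1−l)AG(x⁰) + l·AG(x¹) + l(1−l)·(τσ' + e₂(d))`, `τ = m+r₁+r₂+r₃`, `σ' = m+s₁+s₂+s₃`,
`d_i = s_i − r_i`. [cite: Gladkov2024StrongFKG, proof of Thm. 2.1] -/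
theorem AG_coord_chord (q u₁ u₂ u₃ t s₁ s₂ s₃ m r₁ r₂ r₃ l : R) :
    AG (q - l * (s₁ + s₂ + s₃ + m)) (u₁ + l * (s₁ - r₁)) (u₂ + l * (s₂ - r₂)) (u₃ + l * (s₃ - r₃))
        (t + l * (m + r₁ + r₂ + r₃)) =
      (1 - l) * AG q u₁ u₂ u₃ t +
        l * AG (q - (s₁ + s₂ + s₃ + m)) (u₁ + (s₁ - r₁)) (u₂ + (s₂ - r₂)) (u₃ + (s₃ - r₃)) (t + (m + r₁ + r₂ + r₃)) +
        l * (1 - l) * ((m + r₁ + r₂ + r₃) * (m + s₁ + s₂ + s₃) +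
          ((s₁ - r₁) * (s₂ - r₂) + (s₁ - r₁) * (s₃ - r₃) + (s₂ - r₂) * (s₃ - r₃))) := by
  simp only [AG]
  ring

/-- The chord coefficient of `AG` is a sum of products of nonnegative masses:
`τσ' + e₂(s − r) = m² + m(r+s) + Σ_i r_i s_i + e₂(r) + e₂(s)`. [cite: Gladkov2024StrongFKG, proof of Thm. 2.1 ("G ≥ 0")] -/
theorem coordGamma_eq (s₁ s₂ s₃ m r₁ r₂ r₃ : R) :
    (m + r₁ + r₂ + r₃) * (m + s₁ + s₂ + s₃) +
        ((s₁ - r₁) * (s₂ - r₂) + (s₁ - r₁) * (s₃ - r₃) + (s₂ - r₂) * (s₃ - r₃)) =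
      m ^ 2 + m * (r₁ + r₂ + r₃ + s₁ + s₂ + s₃) + (r₁ * s₁ + r₂ * s₂ + r₃ * s₃) +
        (r₁ * r₂ + r₁ * r₃ + r₂ * r₃) + (s₁ * s₂ + s₁ * s₃ + s₂ * s₃) := by
  ring

/-- **The AG⁺ chord identity for an arbitrary coordinate.**  With `Ξ = σ·AG − e₃` (`σ` = total mass, conserved along the segment):
`Ξ(x_l) = (1−l)Ξ(x⁰) + l·Ξ(x¹) + l(1−l)·K_l`,  `K_l = σ(τσ' + e₂(d)) + Σ_{i<j} d_i d_j u_k + (1+l) d₁d₂d₃`. [folklore] -/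
theorem Xi_coord_chord (q u₁ u₂ u₃ t s₁ s₂ s₃ m r₁ r₂ r₃ l : R) :
    Xi (q - l * (s₁ + s₂ + s₃ + m)) (u₁ + l * (s₁ - r₁)) (u₂ + l * (s₂ - r₂)) (u₃ + l * (s₃ - r₃))
        (t + l * (m + r₁ + r₂ + r₃)) =
      (1 - l) * Xi q u₁ u₂ u₃ t +
        l * Xi (q - (s₁ + s₂ + s₃ + m)) (u₁ + (s₁ - r₁)) (u₂ + (s₂ - r₂)) (u₃ + (s₃ - r₃)) (t + (m + r₁ + r₂ + r₃)) +
        l * (1 - l) *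
          ((q + u₁ + u₂ + u₃ + t) *
              ((m + r₁ + r₂ + r₃) * (m + s₁ + s₂ + s₃) +
                ((s₁ - r₁) * (s₂ - r₂) + (s₁ - r₁) * (s₃ - r₃) + (s₂ - r₂) * (s₃ - r₃))) +
            ((s₁ - r₁) * (s₂ - r₂) * u₃ + (s₁ - r₁) * (s₃ - r₃) * u₂ + (s₂ - r₂) * (s₃ - r₃) * u₁) +
            (1 + l) * ((s₁ - r₁) * (s₂ - r₂) * (s₃ - r₃))) := by
  simp only [Xi]
  ring

/-- **The `H_{q+t}` chord identity for an arbitrary coordinate.**  With `Γ = τσ' + e₂(d)` and `K_l` as in `Xi_coord_chord`: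
`Hqt(x_l) = (1−l)Hqt(x⁰) + l·Hqt(x¹) + l(1−l)·[K_l + (Σd)(AG(x¹) − AG(x⁰)) − (u₁+u₂+u₃ + lΣd)·Γ]`
(the last, negative, term is why `H_{q+t}` has no single-coordinate step). [folklore] -/
theorem Hqt_coord_chord (q u₁ u₂ u₃ t s₁ s₂ s₃ m r₁ r₂ r₃ l : R) :
    Hqt (q - l * (s₁ + s₂ + s₃ + m)) (u₁ + l * (s₁ - r₁)) (u₂ + l * (s₂ - r₂)) (u₃ + l * (s₃ - r₃))
        (t + l * (m + r₁ + r₂ + r₃)) =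
      (1 - l) * Hqt q u₁ u₂ u₃ t +
        l * Hqt (q - (s₁ + s₂ + s₃ + m)) (u₁ + (s₁ - r₁)) (u₂ + (s₂ - r₂)) (u₃ + (s₃ - r₃)) (t + (m + r₁ + r₂ + r₃)) +
        l * (1 - l) *
          (((q + u₁ + u₂ + u₃ + t) *
                ((m + r₁ + r₂ + r₃) * (m + s₁ + s₂ + s₃) +
                  ((s₁ - r₁) * (s₂ - r₂) + (s₁ - r₁) * (s₃ - r₃) + (s₂ - r₂) * (s₃ - r₃))) +
              ((s₁ - r₁) * (s₂ - r₂) * u₃ + (s₁ - r₁) * (s₃ - r₃) * u₂ + (s₂ - r₂) * (s₃ - r₃) * u₁) +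
              (1 + l) * ((s₁ - r₁) * (s₂ - r₂) * (s₃ - r₃))) +
            ((s₁ - r₁) + (s₂ - r₂) + (s₃ - r₃)) *
              (AG (q - (s₁ + s₂ + s₃ + m)) (u₁ + (s₁ - r₁)) (u₂ + (s₂ - r₂)) (u₃ + (s₃ - r₃)) (t + (m + r₁ + r₂ + r₃)) -
                AG q u₁ u₂ u₃ t) -
            ((u₁ + u₂ + u₃) + l * ((s₁ - r₁) + (s₂ - r₂) + (s₃ - r₃))) *
              ((m + r₁ + r₂ + r₃) * (m + s₁ + s₂ + s₃) +
                ((s₁ - r₁) * (s₂ - r₂) + (s₁ - r₁) * (s₃ - r₃) + (s₂ - r₂) * (s₃ - r₃)))) := by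
  simp only [Hqt, AG]
  ring

end Identities

section Nonnegativity

/-- The chord coefficient of `AG` is nonnegative for nonnegative transition masses. [cite: Gladkov2024StrongFKG, proof of Thm. 2.1] -/
theorem coordGamma_nonneg {s₁ s₂ s₃ m r₁ r₂ r₃ : ℝ} (hs₁ : 0 ≤ s₁) (hs₂ : 0 ≤ s₂) (hs₃ : 0 ≤ s₃) (hm : 0 ≤ m)
    (hr₁ : 0 ≤ r₁) (hr₂ : 0 ≤ r₂) (hr₃ : 0 ≤ r₃) :
    0 ≤ (m + r₁ + r₂ + r₃) * (m + s₁ + s₂ + s₃) +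
        ((s₁ - r₁) * (s₂ - r₂) + (s₁ - r₁) * (s₃ - r₃) + (s₂ - r₂) * (s₃ - r₃)) := by
  rw [coordGamma_eq]
  positivity

/-- **Concavity of `AG` across an arbitrary coordinate** (Gladkov): `AG(x_l) ≥ (1−l)AG(x⁰) + l·AG(x¹)` for `l ∈ [0,1]` and nonnegative
transition masses. [cite: Gladkov2024StrongFKG, proof of Thm. 2.1] -/
theorem AG_coord_chord_ge {q u₁ u₂ u₃ t s₁ s₂ s₃ m r₁ r₂ r₃ l : ℝ} (hs₁ : 0 ≤ s₁) (hs₂ : 0 ≤ s₂) (hs₃ : 0 ≤ s₃)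
    (hm : 0 ≤ m) (hr₁ : 0 ≤ r₁) (hr₂ : 0 ≤ r₂) (hr₃ : 0 ≤ r₃) (hl₀ : 0 ≤ l) (hl₁ : l ≤ 1) :
    (1 - l) * AG q u₁ u₂ u₃ t +
        l * AG (q - (s₁ + s₂ + s₃ + m)) (u₁ + (s₁ - r₁)) (u₂ + (s₂ - r₂)) (u₃ + (s₃ - r₃)) (t + (m + r₁ + r₂ + r₃)) ≤
      AG (q - l * (s₁ + s₂ + s₃ + m)) (u₁ + l * (s₁ - r₁)) (u₂ + l * (s₂ - r₂)) (u₃ + l * (s₃ - r₃))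
        (t + l * (m + r₁ + r₂ + r₃)) := by
  rw [AG_coord_chord]
  have hG := coordGamma_nonneg hs₁ hs₂ hs₃ hm hr₁ hr₂ hr₃
  have hl : 0 ≤ l * (1 - l) := mul_nonneg hl₀ (by linarith)
  linarith [mul_nonneg hl hG]

/-- **Same-sign coordinates are good for AG⁺.**  If the petal derivatives `d_i = s_i − r_i` are all `≥ 0`, or all `≤ 0` (with the
transition mass `r_i` out of petal `i` at most `u_i`, as it is for a law), then the chord coefficient `K_l` of `Ξ` is nonnegative
(`l ∈ [0,1]`, all cells and masses nonnegative). [folklore] -/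
theorem Xi_coordK_nonneg_of_sameSign {q u₁ u₂ u₃ t s₁ s₂ s₃ m r₁ r₂ r₃ l : ℝ} (hq : 0 ≤ q) (hu₁ : 0 ≤ u₁) (hu₂ : 0 ≤ u₂)
    (hu₃ : 0 ≤ u₃) (ht : 0 ≤ t) (hs₁ : 0 ≤ s₁) (hs₂ : 0 ≤ s₂) (hs₃ : 0 ≤ s₃) (hm : 0 ≤ m) (hr₁ : 0 ≤ r₁) (hr₂ : 0 ≤ r₂)
    (hr₃ : 0 ≤ r₃) (_hru₁ : r₁ ≤ u₁) (hru₂ : r₂ ≤ u₂) (hru₃ : r₃ ≤ u₃) (hl₀ : 0 ≤ l) (hl₁ : l ≤ 1)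
    (hsign : (0 ≤ s₁ - r₁ ∧ 0 ≤ s₂ - r₂ ∧ 0 ≤ s₃ - r₃) ∨ (s₁ - r₁ ≤ 0 ∧ s₂ - r₂ ≤ 0 ∧ s₃ - r₃ ≤ 0)) :
    0 ≤ (q + u₁ + u₂ + u₃ + t) *
          ((m + r₁ + r₂ + r₃) * (m + s₁ + s₂ + s₃) +
            ((s₁ - r₁) * (s₂ - r₂) + (s₁ - r₁) * (s₃ - r₃) + (s₂ - r₂) * (s₃ - r₃))) +
        ((s₁ - r₁) * (s₂ - r₂) * u₃ + (s₁ - r₁) * (s₃ - r₃) * u₂ + (s₂ - r₂) * (s₃ - r₃) * u₁) +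
        (1 + l) * ((s₁ - r₁) * (s₂ - r₂) * (s₃ - r₃)) := by
  have hσ : 0 ≤ q + u₁ + u₂ + u₃ + t := by linarith
  have hG := coordGamma_nonneg hs₁ hs₂ hs₃ hm hr₁ hr₂ hr₃
  have h1 : 0 ≤ (q + u₁ + u₂ + u₃ + t) *
      ((m + r₁ + r₂ + r₃) * (m + s₁ + s₂ + s₃) +
        ((s₁ - r₁) * (s₂ - r₂) + (s₁ - r₁) * (s₃ - r₃) + (s₂ - r₂) * (s₃ - r₃))) := mul_nonneg hσ hG
  set d₁ := s₁ - r₁ with hd₁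
  set d₂ := s₂ - r₂ with hd₂
  set d₃ := s₃ - r₃ with hd₃
  rcases hsign with ⟨h₁, h₂, h₃⟩ | ⟨h₁, h₂, h₃⟩
  · -- all derivatives nonnegative: every term is nonnegative
    have h12 : 0 ≤ d₁ * d₂ := mul_nonneg h₁ h₂
    have h13 : 0 ≤ d₁ * d₃ := mul_nonneg h₁ h₃
    have h23 : 0 ≤ d₂ * d₃ := mul_nonneg h₂ h₃
    have h123 : 0 ≤ d₁ * d₂ * d₃ := mul_nonneg h12 h₃
    have hl' : 0 ≤ 1 + l := by linarith
    linarith [h1, mul_nonneg h12 hu₃, mul_nonneg h13 hu₂, mul_nonneg h23 hu₁, mul_nonneg hl' h123]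
  · -- all derivatives nonpositive: pair products are ≥ 0 and dominate the triple product since |d_i| ≤ u_i
    have h12 : 0 ≤ d₁ * d₂ := mul_nonneg_of_nonpos_of_nonpos h₁ h₂
    have h13 : 0 ≤ d₁ * d₃ := mul_nonneg_of_nonpos_of_nonpos h₁ h₃
    have h23 : 0 ≤ d₂ * d₃ := mul_nonneg_of_nonpos_of_nonpos h₂ h₃
    have hb₃ : -u₃ ≤ d₃ := by rw [hd₃]; linarith
    have hb₂ : -u₂ ≤ d₂ := by rw [hd₂]; linarith
    have P1 : d₁ * d₂ * (-u₃) ≤ d₁ * d₂ * d₃ := mul_le_mul_of_nonneg_left hb₃ h12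
    have P2 : d₁ * d₃ * (-u₂) ≤ d₁ * d₃ * d₂ := mul_le_mul_of_nonneg_left hb₂ h13
    have P1' : -(d₁ * d₂ * u₃) ≤ d₁ * d₂ * d₃ := by
      have e : d₁ * d₂ * (-u₃) = -(d₁ * d₂ * u₃) := by ring
      linarith [P1, e]
    have P2' : -(d₁ * d₃ * u₂) ≤ d₁ * d₂ * d₃ := by
      have e : d₁ * d₃ * (-u₂) = -(d₁ * d₃ * u₂) := by ring
      have e' : d₁ * d₃ * d₂ = d₁ * d₂ * d₃ := by ring
      linarith [P2, e, e']
    have P3 : d₁ * d₂ * d₃ ≤ 0 := mul_nonpos_iff.mpr (Or.inl ⟨h12, h₃⟩)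
    have P4 : 2 * (d₁ * d₂ * d₃) ≤ (1 + l) * (d₁ * d₂ * d₃) := by
      have e : 0 ≤ (l - 1) * (d₁ * d₂ * d₃) := mul_nonneg_of_nonpos_of_nonpos (by linarith) P3
      linarith [e, (by ring : (l - 1) * (d₁ * d₂ * d₃) = (1 + l) * (d₁ * d₂ * d₃) - 2 * (d₁ * d₂ * d₃))]
    have T23 : 0 ≤ d₂ * d₃ * u₁ := mul_nonneg h23 hu₁
    linarith [h1, P1', P2', P4, T23]

/-- **AG⁺ across a same-sign coordinate** (graph-free 'easy case' of the edge induction): if `Ξ ≥ 0` at both endpoint laws and the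
coordinate's petal derivatives have one sign, then `Ξ ≥ 0` along the whole segment. [folklore] -/
theorem Xi_coord_nonneg_of_sameSign {q u₁ u₂ u₃ t s₁ s₂ s₃ m r₁ r₂ r₃ l : ℝ} (hq : 0 ≤ q) (hu₁ : 0 ≤ u₁) (hu₂ : 0 ≤ u₂)
    (hu₃ : 0 ≤ u₃) (ht : 0 ≤ t) (hs₁ : 0 ≤ s₁) (hs₂ : 0 ≤ s₂) (hs₃ : 0 ≤ s₃) (hm : 0 ≤ m) (hr₁ : 0 ≤ r₁) (hr₂ : 0 ≤ r₂)
    (hr₃ : 0 ≤ r₃) (hru₁ : r₁ ≤ u₁) (hru₂ : r₂ ≤ u₂) (hru₃ : r₃ ≤ u₃) (hl₀ : 0 ≤ l) (hl₁ : l ≤ 1)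
    (hsign : (0 ≤ s₁ - r₁ ∧ 0 ≤ s₂ - r₂ ∧ 0 ≤ s₃ - r₃) ∨ (s₁ - r₁ ≤ 0 ∧ s₂ - r₂ ≤ 0 ∧ s₃ - r₃ ≤ 0))
    (h0 : 0 ≤ Xi q u₁ u₂ u₃ t)
    (h1 : 0 ≤ Xi (q - (s₁ + s₂ + s₃ + m)) (u₁ + (s₁ - r₁)) (u₂ + (s₂ - r₂)) (u₃ + (s₃ - r₃)) (t + (m + r₁ + r₂ + r₃))) :
    0 ≤ Xi (q - l * (s₁ + s₂ + s₃ + m)) (u₁ + l * (s₁ - r₁)) (u₂ + l * (s₂ - r₂)) (u₃ + l * (s₃ - r₃))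
        (t + l * (m + r₁ + r₂ + r₃)) := by
  rw [Xi_coord_chord]
  have hK := Xi_coordK_nonneg_of_sameSign hq hu₁ hu₂ hu₃ ht hs₁ hs₂ hs₃ hm hr₁ hr₂ hr₃ hru₁ hru₂ hru₃ hl₀ hl₁ hsign
  have hl : 0 ≤ l * (1 - l) := mul_nonneg hl₀ (by linarith)
  have hA : 0 ≤ (1 - l) * Xi q u₁ u₂ u₃ t := mul_nonneg (by linarith) h0
  have hB : 0 ≤ l * Xi (q - (s₁ + s₂ + s₃ + m)) (u₁ + (s₁ - r₁)) (u₂ + (s₂ - r₂)) (u₃ + (s₃ - r₃))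
      (t + (m + r₁ + r₂ + r₃)) := mul_nonneg hl₀ h1
  linarith [hA, hB, mul_nonneg hl hK]

end Nonnegativity

section Normalised

variable {R : Type*} [CommRing R]

/-- **Chord identity for the NORMALISED potential `Ψ = Ξ/ρ`, `ρ = u₁+u₂+u₃+t` (= `1 − q`, the mass of 'some pair joined'),
cleared of denominators.**  With `ρ⁰ = ρ(x⁰)`, `ρ¹ = ρ(x¹) = ρ⁰ + σ'` (`σ' = m+s₁+s₂+s₃`), `ρ(x_l) = ρ⁰ + lσ'` and `K_l` the bracket of
`Xi_coord_chord`:  `ρ⁰ρ¹·Ξ(x_l) − ρ(x_l)·[(1−l)ρ¹Ξ(x⁰) + lρ⁰Ξ(x¹)] = l(1−l)·[ρ⁰ρ¹·K_l + σ'·(ρ⁰Ξ(x¹) − ρ¹Ξ(x⁰))]`.  Dividing by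
`ρ⁰ρ¹ρ(x_l) > 0` this is `Ψ(x_l) − (1−l)Ψ(x⁰) − lΨ(x¹) = l(1−l)[K_l + σ'(Ψ(x¹) − Ψ(x⁰))]/ρ(x_l)`: the bracket of the normalised potential is
the plain bracket plus (influence on `q`) × (gain of `Ψ` across the coordinate) — the form in which 'exists a good edge' survives rings
(prim-ineq-gen-2, EDGE-STEP.md §6a; this seat, FINDING-G3.md G6). [folklore] -/
theorem Psi_coord_chord_num (q u₁ u₂ u₃ t s₁ s₂ s₃ m r₁ r₂ r₃ l : R) :
    (u₁ + u₂ + u₃ + t) * (u₁ + u₂ + u₃ + t + (m + s₁ + s₂ + s₃)) *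
          Xi (q - l * (s₁ + s₂ + s₃ + m)) (u₁ + l * (s₁ - r₁)) (u₂ + l * (s₂ - r₂)) (u₃ + l * (s₃ - r₃))
            (t + l * (m + r₁ + r₂ + r₃)) -
        (u₁ + u₂ + u₃ + t + l * (m + s₁ + s₂ + s₃)) *
          ((1 - l) * (u₁ + u₂ + u₃ + t + (m + s₁ + s₂ + s₃)) * Xi q u₁ u₂ u₃ t +
            l * (u₁ + u₂ + u₃ + t) *
              Xi (q - (s₁ + s₂ + s₃ + m)) (u₁ + (s₁ - r₁)) (u₂ + (s₂ - r₂)) (u₃ + (s₃ - r₃)) (t + (m + r₁ + r₂ + r₃))) =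
      l * (1 - l) *
        ((u₁ + u₂ + u₃ + t) * (u₁ + u₂ + u₃ + t + (m + s₁ + s₂ + s₃)) *
            ((q + u₁ + u₂ + u₃ + t) *
                ((m + r₁ + r₂ + r₃) * (m + s₁ + s₂ + s₃) +
                  ((s₁ - r₁) * (s₂ - r₂) + (s₁ - r₁) * (s₃ - r₃) + (s₂ - r₂) * (s₃ - r₃))) +
              ((s₁ - r₁) * (s₂ - r₂) * u₃ + (s₁ - r₁) * (s₃ - r₃) * u₂ + (s₂ - r₂) * (s₃ - r₃) * u₁) +
              (1 + l) * ((s₁ - r₁) * (s₂ - r₂) * (s₃ - r₃))) +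
          (m + s₁ + s₂ + s₃) *
            ((u₁ + u₂ + u₃ + t) *
                Xi (q - (s₁ + s₂ + s₃ + m)) (u₁ + (s₁ - r₁)) (u₂ + (s₂ - r₂)) (u₃ + (s₃ - r₃)) (t + (m + r₁ + r₂ + r₃)) -
              (u₁ + u₂ + u₃ + t + (m + s₁ + s₂ + s₃)) * Xi q u₁ u₂ u₃ t)) := by
  simp only [Xi]
  ring

end Normalised

end CubicThreePointCoordinate

end Summit.CriticalPhenomena.PercolationContinuityZ3.Theorems
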